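import Summits.QuantumFields.YangMills.Theorems.PoincareLipschitzKuhnInterpolant
import Summits.QuantumFields.YangMills.Theorems.PoincareLipschitzKuhnSimplexVolume
import Summits.QuantumFields.YangMills.Theorems.PoincareLipschitzKuhnPathSums
import Mathlib.MeasureTheory.Integral.Bochner.Set
import Literature.Analysis.Convexity.AnisotropicPerimeterBox
import HarnessLib

/-!
# The Courant `P1` interpolant on the Freudenthal–Kuhn triangulation — THE ENERGY DICTIONARY: the per-cube identity, the
# big-box identity, and the SANDWICH against the organ's lattice Dirichlet energy (K2 organ `hImproveCoreFlat`, ORGAN memo §4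
# brick B3 «compactness ∕ interpolation package», mesh-side half; LINE 25 `stub_latticeToContinuumLimit` (Γ1)∕(Γ2) letters;
# cell ym3-torus, seat px7 g7)

Helper toward crux `stmt-QuantumFields-19936` (`Summit.QuantumFields.YangMills.Theses.UnitScaleTilt.HistoryTailL`).  Siblings:
`PoincareLipschitzKuhnHat` (hat letters), `PoincareLipschitzKuhnInterpolant` (affine structure, derivative, energy density
`∑ i, ‖fderiv ℝ I x (EuclideanSpace.single i 1)‖² = path energy` on each open Kuhn simplex), `PoincareLipschitzKuhnSimplexVolume`
(each open Kuhn simplex has volume `1∕6`; the cube minus its simplices and the coordinate hyperplanes are null),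
`PoincareLipschitzKuhnPathSums` (the combinatorial sandwich of the path sums against the organ's bond sums); the null coordinate
hyperplanes (faces between neighbouring cubes) are lit ✓`Literature.Analysis.Convexity.volume_setOf_apply_eq_zero_three` (cited, not restated).

WHAT IS PROVED (all `theorem`s; the energy density is written in LINE 25's own letters throughout).
§6 `integrableOn_openSimplex_energyDensity`, `integrableOn_cube_energyDensity`, ★★★`integral_cube_energyDensity_eq` — for a
lattice map `u : Zd 3 → E` whose eight cube corners `y + {0,1}³` lie in the data set `S`,
  `∫_{y < x < y+1} ∑_i ‖∂_i I‖² = (1∕6) · ∑_{σ ∈ S₃} (‖u(y+e_{σ0}) − u y‖² + ‖u(y+e_{σ0}+e_{σ1}) − u(y+e_{σ0})‖² + ‖u(y+𝟙) − u(y+e_{σ0}+e_{σ1})‖²)`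
(the six monotone lattice paths; regrouped by edges this is weight `1∕3` on the six cube edges at the corners `y`, `y+𝟙` and `1∕6`
on the six middle edges).  §8 `disjoint_cube`, `cube_subset_bigBox`, `volume_bigBox_diff_eq_zero` (floor argument),
`iUnion_cube_ae_eq_bigBox`, ★★`integral_bigBox_energyDensity_eq` and ★★★`bondEnergy_le_integral_bigBox_le_bondEnergy`:
  `E(box z (R−1)) ≤ ∫_{z−R < x < z+R+1} ∑_i ‖fderiv ℝ I x (EuclideanSpace.single i 1)‖² ≤ E(box z (R+1))`
— the lattice Dirichlet energy and the continuum Dirichlet energy of the interpolant AGREE with constant ONE up to one boundary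
layer of lattice bonds (after the blow-down rescaling `x ↦ z + R·x` this is the (Γ1) compactness input and the (Γ2) «no loss at
the mesh level» input of `stub_latticeToContinuumLimit`; the Luckhaus pasting (Γ3) and the continuum facts are NOT here).

HONEST: measure-theoretic and combinatorial bookkeeping over the siblings' letters; nothing of `stub_latticeToContinuumLimit`,
`hImproveCoreFlat`, K1, `MeanDeviationL`, `BlockLipschitzL`, `HistoryTailL` or any rung statement is proved; YM₃ on T³ is ladder
rung R3 — not d = 4, not infinite volume, not a mass gap, not Clay.
-/

open scoped BigOperators
open Literature.MathematicalPhysics.QuantumFieldTheory.Balaban1983to89 B4Eq19LatticeOperators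

noncomputable section

namespace Summit.QuantumFields.YangMills.Theorems.PoincareLipschitzKuhnEnergy

open MeasureTheory
open Summit.QuantumFields.YangMills.Theorems.PoincareLipschitzKuhnHat
open Summit.QuantumFields.YangMills.Theorems.PoincareLipschitzKuhnInterpolant
open Summit.QuantumFields.YangMills.Theorems.PoincareLipschitzKuhnSimplexVolume

variable {E : Type*} [NormedAddCommGroup E] [NormedSpace ℝ E]
variable (φ : (Fin 3 → ℝ) → ℝ)

/-! ## §6 The per-cube energy identity -/

/-- The open Kuhn simplex of `σ` at `y` lies in the open unit cube at `y`. -/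
theorem openSimplex_subset_cube (y : Zd 3) (σ : Equiv.Perm (Fin 3)) :
    {x : EuclideanSpace ℝ (Fin 3) | (y (σ 2) : ℝ) < x (σ 2) ∧ x (σ 2) - y (σ 2) < x (σ 1) - y (σ 1) ∧
      x (σ 1) - y (σ 1) < x (σ 0) - y (σ 0) ∧ x (σ 0) < y (σ 0) + 1} ⊆
    {x : EuclideanSpace ℝ (Fin 3) | ∀ i, (y i : ℝ) < x i ∧ x i < y i + 1} := by
  rintro x ⟨h0, h1, h2, h3⟩ i
  obtain ⟨j, rfl⟩ : ∃ j, i = σ j := ⟨σ.symm i, by simp⟩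
  have lo0 : (y (σ 0) : ℝ) < x (σ 0) := by linarith
  have lo1 : (y (σ 1) : ℝ) < x (σ 1) := by linarith
  have hi1 : x (σ 1) < (y (σ 1) : ℝ) + 1 := by linarith
  have hi2 : x (σ 2) < (y (σ 2) : ℝ) + 1 := by linarith
  fin_cases j
  · exact ⟨lo0, h3⟩
  · exact ⟨lo1, hi1⟩
  · exact ⟨h0, hi2⟩

/-- The open unit cube at `y` coincides with the union of its six open Kuhn simplices up to a null set. -/
theorem iUnion_openSimplex_ae_eq_cube (y : Zd 3) :
    (⋃ σ ∈ (Finset.univ : Finset (Equiv.Perm (Fin 3))),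
      {x : EuclideanSpace ℝ (Fin 3) | (y (σ 2) : ℝ) < x (σ 2) ∧ x (σ 2) - y (σ 2) < x (σ 1) - y (σ 1) ∧
        x (σ 1) - y (σ 1) < x (σ 0) - y (σ 0) ∧ x (σ 0) < y (σ 0) + 1}) =ᵐ[volume]
    {x : EuclideanSpace ℝ (Fin 3) | ∀ i, (y i : ℝ) < x i ∧ x i < y i + 1} := by
  have hbU : (⋃ σ ∈ (Finset.univ : Finset (Equiv.Perm (Fin 3))),
      {x : EuclideanSpace ℝ (Fin 3) | (y (σ 2) : ℝ) < x (σ 2) ∧ x (σ 2) - y (σ 2) < x (σ 1) - y (σ 1) ∧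
        x (σ 1) - y (σ 1) < x (σ 0) - y (σ 0) ∧ x (σ 0) < y (σ 0) + 1}) =
      ⋃ σ : Equiv.Perm (Fin 3), {x : EuclideanSpace ℝ (Fin 3) | (y (σ 2) : ℝ) < x (σ 2) ∧
        x (σ 2) - y (σ 2) < x (σ 1) - y (σ 1) ∧ x (σ 1) - y (σ 1) < x (σ 0) - y (σ 0) ∧ x (σ 0) < y (σ 0) + 1} := by
    ext x; simp
  rw [hbU, ae_eq_set]
  constructor
  · refine measure_mono_null (fun x hx => ?_) (measure_empty (μ := volume))
    exact absurd (Set.iUnion_subset (fun σ => openSimplex_subset_cube y σ) hx.1) hx.2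
  · exact volume_cube_diff_eq_zero y

/-- The path vertices of every Kuhn simplex at `y` are among the eight corners `y + {0,1}³`. -/
theorem pathVertices_mem (S : Finset (Zd 3)) (y : Zd 3) (hS : ∀ v : Zd 3, (∀ i, v i = 0 ∨ v i = 1) → y + v ∈ S)
    (σ : Equiv.Perm (Fin 3)) :
    y ∈ S ∧ y + unitVec (σ 0) ∈ S ∧ y + unitVec (σ 0) + unitVec (σ 1) ∈ S ∧
      y + unitVec (σ 0) + unitVec (σ 1) + unitVec (σ 2) ∈ S := by
  have h01 : ∀ k : ℕ, ∀ i : Fin 3, (fun i => if ((σ.symm i : Fin 3) : ℕ) < k then (1:ℤ) else 0) i = 0 ∨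
      (fun i => if ((σ.symm i : Fin 3) : ℕ) < k then (1:ℤ) else 0) i = 1 := by
    intro k i; dsimp only; split_ifs
    · exact Or.inr rfl
    · exact Or.inl rfl
  refine ⟨?_, ?_, ?_, ?_⟩
  · simpa using hS 0 (fun i => Or.inl rfl)
  · rw [← pathVertex_one σ]; exact hS _ (h01 1)
  · rw [add_assoc, ← pathVertex_two σ]; exact hS _ (h01 2)
  · rw [add_assoc, add_assoc, ← add_assoc (unitVec (σ 0)), ← pathVertex_three σ]; exact hS _ (h01 3)

/-- On each open Kuhn simplex the energy density is the constant path energy, hence integrable there. -/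
theorem integrableOn_openSimplex_energyDensity
    (hφ : ∀ t, φ t = max 0 (1 + min 0 (min (t 0) (min (t 1) (t 2))) - max 0 (max (t 0) (max (t 1) (t 2)))))
    (S : Finset (Zd 3)) (u : Zd 3 → E) (I : EuclideanSpace ℝ (Fin 3) → E)
    (hI : ∀ x, I x = ∑ w ∈ S, φ (fun i => x i - (w i : ℝ)) • u w)
    (y : Zd 3) (hS : ∀ v : Zd 3, (∀ i, v i = 0 ∨ v i = 1) → y + v ∈ S) (σ : Equiv.Perm (Fin 3)) :
    IntegrableOn (fun x => ∑ i : Fin 3, ‖fderiv ℝ I x (EuclideanSpace.single i (1:ℝ))‖ ^ 2)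
      {x : EuclideanSpace ℝ (Fin 3) | (y (σ 2) : ℝ) < x (σ 2) ∧ x (σ 2) - y (σ 2) < x (σ 1) - y (σ 1) ∧
        x (σ 1) - y (σ 1) < x (σ 0) - y (σ 0) ∧ x (σ 0) < y (σ 0) + 1} volume := by
  obtain ⟨hS0, hS1, hS2, hS3⟩ := pathVertices_mem S y hS σ
  refine (integrableOn_const (C := ‖u (y + unitVec (σ 0)) - u y‖ ^ 2
        + ‖u (y + unitVec (σ 0) + unitVec (σ 1)) - u (y + unitVec (σ 0))‖ ^ 2
        + ‖u (y + unitVec (σ 0) + unitVec (σ 1) + unitVec (σ 2)) - u (y + unitVec (σ 0) + unitVec (σ 1))‖ ^ 2)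
      (by rw [volume_openSimplex y σ]; norm_num)).congr_fun (fun x hx => ?_) (isOpen_openSimplex y σ).measurableSet
  exact (energyDensity_interp_eq φ hφ S u I hI y σ hS0 hS1 hS2 hS3 hx.1 hx.2.1 hx.2.2.1 hx.2.2.2).symm

/-- The energy density of the interpolant is integrable on the open unit cube at `y` (corners in `S`). -/
theorem integrableOn_cube_energyDensity
    (hφ : ∀ t, φ t = max 0 (1 + min 0 (min (t 0) (min (t 1) (t 2))) - max 0 (max (t 0) (max (t 1) (t 2)))))
    (S : Finset (Zd 3)) (u : Zd 3 → E) (I : EuclideanSpace ℝ (Fin 3) → E)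
    (hI : ∀ x, I x = ∑ w ∈ S, φ (fun i => x i - (w i : ℝ)) • u w)
    (y : Zd 3) (hS : ∀ v : Zd 3, (∀ i, v i = 0 ∨ v i = 1) → y + v ∈ S) :
    IntegrableOn (fun x => ∑ i : Fin 3, ‖fderiv ℝ I x (EuclideanSpace.single i (1:ℝ))‖ ^ 2)
      {x : EuclideanSpace ℝ (Fin 3) | ∀ i, (y i : ℝ) < x i ∧ x i < y i + 1} volume := by
  have h := (integrableOn_finset_iUnion (μ := volume) (s := (Finset.univ : Finset (Equiv.Perm (Fin 3))))
    (f := fun x => ∑ i : Fin 3, ‖fderiv ℝ I x (EuclideanSpace.single i (1:ℝ))‖ ^ 2)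
    (t := fun σ => {x : EuclideanSpace ℝ (Fin 3) | (y (σ 2) : ℝ) < x (σ 2) ∧ x (σ 2) - y (σ 2) < x (σ 1) - y (σ 1) ∧
        x (σ 1) - y (σ 1) < x (σ 0) - y (σ 0) ∧ x (σ 0) < y (σ 0) + 1})).mpr
    (fun σ _ => integrableOn_openSimplex_energyDensity φ hφ S u I hI y hS σ)
  exact h.congr_set_ae (iUnion_openSimplex_ae_eq_cube y).symm

/-- ★★★ THE PER-CUBE ENERGY IDENTITY.  If the eight corners of the unit cube at `y` carry data (`y + {0,1}³ ⊆ S`), the Dirichlet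
energy of the Courant `P1` interpolant over the open cube — in LINE 25's letters `∑ i, ‖fderiv ℝ I x (EuclideanSpace.single i 1)‖²`
— is `1∕6` times the sum over the six Kuhn simplices of the bond energies of their monotone lattice paths
`y → y + e_{σ0} → y + e_{σ0} + e_{σ1} → y + 𝟙`.  (Regrouped by edges: weight `1∕3` on the six cube edges at the corners `y`,
`y + 𝟙`, weight `1∕6` on the six middle edges — the monotone-path count `|v|! (2 − |v|)!`.) -/
theorem integral_cube_energyDensity_eq
    (hφ : ∀ t, φ t = max 0 (1 + min 0 (min (t 0) (min (t 1) (t 2))) - max 0 (max (t 0) (max (t 1) (t 2)))))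
    (S : Finset (Zd 3)) (u : Zd 3 → E) (I : EuclideanSpace ℝ (Fin 3) → E)
    (hI : ∀ x, I x = ∑ w ∈ S, φ (fun i => x i - (w i : ℝ)) • u w)
    (y : Zd 3) (hS : ∀ v : Zd 3, (∀ i, v i = 0 ∨ v i = 1) → y + v ∈ S) :
    ∫ x in {x : EuclideanSpace ℝ (Fin 3) | ∀ i, (y i : ℝ) < x i ∧ x i < y i + 1},
        ∑ i : Fin 3, ‖fderiv ℝ I x (EuclideanSpace.single i (1:ℝ))‖ ^ 2 =
      (1 / 6 : ℝ) * ∑ σ : Equiv.Perm (Fin 3), (‖u (y + unitVec (σ 0)) - u y‖ ^ 2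
        + ‖u (y + unitVec (σ 0) + unitVec (σ 1)) - u (y + unitVec (σ 0))‖ ^ 2
        + ‖u (y + unitVec (σ 0) + unitVec (σ 1) + unitVec (σ 2)) - u (y + unitVec (σ 0) + unitVec (σ 1))‖ ^ 2) := by
  set U : Equiv.Perm (Fin 3) → Set (EuclideanSpace ℝ (Fin 3)) := fun σ =>
    {x | (y (σ 2) : ℝ) < x (σ 2) ∧ x (σ 2) - y (σ 2) < x (σ 1) - y (σ 1) ∧
      x (σ 1) - y (σ 1) < x (σ 0) - y (σ 0) ∧ x (σ 0) < y (σ 0) + 1} with hU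
  set g : EuclideanSpace ℝ (Fin 3) → ℝ := fun x => ∑ i : Fin 3, ‖fderiv ℝ I x (EuclideanSpace.single i (1:ℝ))‖ ^ 2 with hg
  set c : Equiv.Perm (Fin 3) → ℝ := fun σ => ‖u (y + unitVec (σ 0)) - u y‖ ^ 2
        + ‖u (y + unitVec (σ 0) + unitVec (σ 1)) - u (y + unitVec (σ 0))‖ ^ 2
        + ‖u (y + unitVec (σ 0) + unitVec (σ 1) + unitVec (σ 2)) - u (y + unitVec (σ 0) + unitVec (σ 1))‖ ^ 2 with hc
  have hUmeas : ∀ σ, MeasurableSet (U σ) := fun σ => (isOpen_openSimplex y σ).measurableSet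
  have hdisj : Set.Pairwise (↑(Finset.univ : Finset (Equiv.Perm (Fin 3)))) (Function.onFun Disjoint U) := by
    intro σ _ τ _ hne
    refine Set.disjoint_left.mpr fun x hxσ hxτ => hne ?_
    exact perm_eq_of_strictChain (x := fun i => x i - (y i : ℝ)) hxσ.2.1 hxσ.2.2.1 hxτ.2.1 hxτ.2.2.1
  have hgU : ∀ σ, ∀ x ∈ U σ, g x = c σ := by
    intro σ x hx
    obtain ⟨hS0, hS1, hS2, hS3⟩ := pathVertices_mem S y hS σ
    exact energyDensity_interp_eq φ hφ S u I hI y σ hS0 hS1 hS2 hS3 hx.1 hx.2.1 hx.2.2.1 hx.2.2.2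
  have hvol : ∀ σ, volume (U σ) = 1 / 6 := fun σ => volume_openSimplex y σ
  have hint : ∀ σ, IntegrableOn g (U σ) volume := fun σ =>
    integrableOn_openSimplex_energyDensity φ hφ S u I hI y hS σ
  calc ∫ x in {x : EuclideanSpace ℝ (Fin 3) | ∀ i, (y i : ℝ) < x i ∧ x i < y i + 1}, g x
        = ∫ x in ⋃ σ ∈ (Finset.univ : Finset (Equiv.Perm (Fin 3))), U σ, g x :=
        (setIntegral_congr_set (iUnion_openSimplex_ae_eq_cube y)).symm
    _ = ∑ σ : Equiv.Perm (Fin 3), ∫ x in U σ, g x :=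
        integral_biUnion_finset _ (fun σ _ => hUmeas σ) hdisj (fun σ _ => hint σ)
    _ = ∑ σ : Equiv.Perm (Fin 3), (1 / 6 : ℝ) * c σ := by
        refine Finset.sum_congr rfl fun σ _ => ?_
        rw [setIntegral_congr_fun (hUmeas σ) (hgU σ), setIntegral_const, smul_eq_mul, measureReal_def, hvol]
        norm_num
    _ = (1 / 6 : ℝ) * ∑ σ : Equiv.Perm (Fin 3), c σ := by rw [Finset.mul_sum]

end Summit.QuantumFields.YangMills.Theorems.PoincareLipschitzKuhnEnergy

namespace Summit.QuantumFields.YangMills.Theorems.PoincareLipschitzKuhnEnergy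

open MeasureTheory
open Summit.QuantumFields.YangMills.Theorems.PoincareLipschitzKuhnHat
open Summit.QuantumFields.YangMills.Theorems.PoincareLipschitzKuhnInterpolant
open Summit.QuantumFields.YangMills.Theorems.PoincareLipschitzKuhnSimplexVolume
open Summit.QuantumFields.YangMills.Theorems.PoincareLipschitzKuhnPathSums

variable {E : Type*} [NormedAddCommGroup E] [NormedSpace ℝ E]
variable (φ : (Fin 3 → ℝ) → ℝ)

/-! ## §8 The big box: `∫` over `{x | z i − R < x i < z i + R + 1}` = the sum of the cube integrals; the SANDWICH -/

/-- Open unit cubes at distinct lattice corners are disjoint. -/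
theorem disjoint_cube {y y' : Zd 3} (h : y ≠ y') :
    Disjoint {x : EuclideanSpace ℝ (Fin 3) | ∀ i, (y i : ℝ) < x i ∧ x i < y i + 1}
      {x : EuclideanSpace ℝ (Fin 3) | ∀ i, (y' i : ℝ) < x i ∧ x i < y' i + 1} := by
  refine Set.disjoint_left.mpr fun x hx hx' => h (funext fun i => ?_)
  have h1 := hx i; have h2 := hx' i
  have ha : (y i : ℝ) < y' i + 1 := by linarith [h1.1, h2.2]
  have hb : (y' i : ℝ) < y i + 1 := by linarith [h2.1, h1.2]
  have ha' : y i < y' i + 1 := by exact_mod_cast ha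
  have hb' : y' i < y i + 1 := by exact_mod_cast hb
  omega

/-- The open unit cube at a corner `y ∈ box z R` lies in the big open box `{z i − R < x i < z i + R + 1}`. -/
theorem cube_subset_bigBox {z y : Zd 3} {R : ℤ} (hy : y ∈ box z R) :
    {x : EuclideanSpace ℝ (Fin 3) | ∀ i, (y i : ℝ) < x i ∧ x i < y i + 1} ⊆
      {x : EuclideanSpace ℝ (Fin 3) | ∀ i, (z i : ℝ) - R < x i ∧ x i < z i + R + 1} := by
  intro x hx i
  have h := abs_le.mp ((mem_box.mp hy) i)
  have h1 : ((z i - R : ℤ) : ℝ) ≤ y i := by exact_mod_cast (by linarith : z i - R ≤ y i)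
  have h2 : (y i : ℝ) ≤ ((z i + R : ℤ) : ℝ) := by exact_mod_cast (by linarith : y i ≤ z i + R)
  push_cast at h1 h2
  exact ⟨by linarith [(hx i).1], by linarith [(hx i).2]⟩

/-- The big open box is covered by the open unit cubes at the corners `y ∈ box z R` up to the (null) coordinate hyperplanes
`x i = m`, `m ∈ [z i − R, z i + R]` (floor argument). -/
theorem volume_bigBox_diff_eq_zero (z : Zd 3) (R : ℤ) :
    volume ({x : EuclideanSpace ℝ (Fin 3) | ∀ i, (z i : ℝ) - R < x i ∧ x i < z i + R + 1} \
      ⋃ y ∈ box z R, {x : EuclideanSpace ℝ (Fin 3) | ∀ i, (y i : ℝ) < x i ∧ x i < y i + 1}) = 0 := by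
  have hsub : ({x : EuclideanSpace ℝ (Fin 3) | ∀ i, (z i : ℝ) - R < x i ∧ x i < z i + R + 1} \
      ⋃ y ∈ box z R, {x : EuclideanSpace ℝ (Fin 3) | ∀ i, (y i : ℝ) < x i ∧ x i < y i + 1}) ⊆
      ⋃ i : Fin 3, ⋃ m ∈ Finset.Icc (z i - R) (z i + R), {x : EuclideanSpace ℝ (Fin 3) | x i = (m : ℝ)} := by
    rintro x ⟨hx, hnot⟩
    -- the floor corner
    set y : Zd 3 := fun i => ⌊x i⌋ with hy
    have hybox : y ∈ box z R := by
      rw [mem_box]; intro i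
      have h1 := (hx i).1; have h2 := (hx i).2
      have hlo : z i - R ≤ ⌊x i⌋ := Int.le_floor.mpr (by push_cast; linarith)
      have hhi : ⌊x i⌋ < z i + R + 1 := Int.floor_lt.mpr (by push_cast; linarith)
      simp only [hy]
      exact abs_le.mpr ⟨by linarith, by linarith⟩
    have hxy : ¬ ∀ i, (y i : ℝ) < x i ∧ x i < y i + 1 := by
      intro h
      exact hnot (Set.mem_biUnion (Finset.mem_coe.mpr hybox) h)
    push Not at hxy
    obtain ⟨i, hi⟩ := hxy
    have hfl : (y i : ℝ) ≤ x i := Int.floor_le (x i)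
    have hlt : x i < (y i : ℝ) + 1 := Int.lt_floor_add_one (x i)
    have heq : x i = (y i : ℝ) := by
      by_contra hne
      exact absurd (hi (lt_of_le_of_ne hfl (fun h => hne h.symm))) (not_le.mpr hlt)
    refine Set.mem_iUnion.mpr ⟨i, Set.mem_biUnion (Finset.mem_coe.mpr ?_) heq⟩
    have := abs_le.mp ((mem_box.mp hybox) i)
    exact Finset.mem_Icc.mpr ⟨by linarith, by linarith⟩
  refine measure_mono_null hsub ?_
  refine (measure_iUnion_null_iff.mpr fun i => ?_)
  refine (measure_biUnion_null_iff (Finset.countable_toSet _)).mpr fun m _ => ?_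
  exact Literature.Analysis.Convexity.volume_setOf_apply_eq_zero_three i (m : ℝ)

/-- The open unit cube is measurable (it is open). -/
theorem measurableSet_cube (y : Zd 3) :
    MeasurableSet {x : EuclideanSpace ℝ (Fin 3) | ∀ i, (y i : ℝ) < x i ∧ x i < y i + 1} := by
  have hc : ∀ i : Fin 3, Continuous fun x : EuclideanSpace ℝ (Fin 3) => x i := fun i =>
    (EuclideanSpace.proj i).continuous
  have : IsOpen {x : EuclideanSpace ℝ (Fin 3) | ∀ i, (y i : ℝ) < x i ∧ x i < y i + 1} := by
    rw [Set.setOf_forall]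
    exact isOpen_iInter_of_finite fun i => (isOpen_lt continuous_const (hc i)).and (isOpen_lt (hc i) continuous_const)
  exact this.measurableSet

/-- The union of the open unit cubes at the corners `y ∈ box z R` is the big open box up to a null set. -/
theorem iUnion_cube_ae_eq_bigBox (z : Zd 3) (R : ℤ) :
    (⋃ y ∈ box z R, {x : EuclideanSpace ℝ (Fin 3) | ∀ i, (y i : ℝ) < x i ∧ x i < y i + 1}) =ᵐ[volume]
      {x : EuclideanSpace ℝ (Fin 3) | ∀ i, (z i : ℝ) - R < x i ∧ x i < z i + R + 1} := by
  have hsub : (⋃ y ∈ box z R, {x : EuclideanSpace ℝ (Fin 3) | ∀ i, (y i : ℝ) < x i ∧ x i < y i + 1}) ⊆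
      {x : EuclideanSpace ℝ (Fin 3) | ∀ i, (z i : ℝ) - R < x i ∧ x i < z i + R + 1} :=
    Set.iUnion₂_subset fun y hy => cube_subset_bigBox (Finset.mem_coe.mp hy)
  refine ae_eq_set.mpr ⟨?_, volume_bigBox_diff_eq_zero z R⟩
  have hempty : (⋃ y ∈ box z R, {x : EuclideanSpace ℝ (Fin 3) | ∀ i, (y i : ℝ) < x i ∧ x i < y i + 1}) \
      {x : EuclideanSpace ℝ (Fin 3) | ∀ i, (z i : ℝ) - R < x i ∧ x i < z i + R + 1} = ∅ :=
    Set.eq_empty_of_forall_notMem fun x hx => hx.2 (hsub hx.1)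
  rw [hempty]; exact measure_empty

/-- ★★ THE BIG-BOX IDENTITY: the Dirichlet energy of the interpolant over the big open box `{z i − R < x i < z i + R + 1}` is the
sum of the per-cube identities over the corners `y ∈ box z R` (data on `box z (R+1)`). -/
theorem integral_bigBox_energyDensity_eq
    (hφ : ∀ t, φ t = max 0 (1 + min 0 (min (t 0) (min (t 1) (t 2))) - max 0 (max (t 0) (max (t 1) (t 2)))))
    (S : Finset (Zd 3)) (u : Zd 3 → E) (I : EuclideanSpace ℝ (Fin 3) → E)
    (hI : ∀ x, I x = ∑ w ∈ S, φ (fun i => x i - (w i : ℝ)) • u w)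
    (z : Zd 3) (R : ℤ) (hS : ∀ w ∈ box z (R + 1), w ∈ S) :
    ∫ x in {x : EuclideanSpace ℝ (Fin 3) | ∀ i, (z i : ℝ) - R < x i ∧ x i < z i + R + 1},
        ∑ i : Fin 3, ‖fderiv ℝ I x (EuclideanSpace.single i (1:ℝ))‖ ^ 2 =
      (1 / 6 : ℝ) * ∑ y ∈ box z R, ∑ σ : Equiv.Perm (Fin 3), (‖u (y + unitVec (σ 0)) - u y‖ ^ 2
        + ‖u (y + unitVec (σ 0) + unitVec (σ 1)) - u (y + unitVec (σ 0))‖ ^ 2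
        + ‖u (y + unitVec (σ 0) + unitVec (σ 1) + unitVec (σ 2)) - u (y + unitVec (σ 0) + unitVec (σ 1))‖ ^ 2) := by
  have hcorner : ∀ y ∈ box z R, ∀ v : Zd 3, (∀ i, v i = 0 ∨ v i = 1) → y + v ∈ S :=
    fun y hy v hv => hS _ (add_mem_box_succ hy hv)
  have hdisj : Set.Pairwise (↑(box z R))
      (Function.onFun Disjoint fun y : Zd 3 => {x : EuclideanSpace ℝ (Fin 3) | ∀ i, (y i : ℝ) < x i ∧ x i < y i + 1}) :=
    fun y _ y' _ hne => disjoint_cube hne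
  rw [← setIntegral_congr_set (iUnion_cube_ae_eq_bigBox z R),
    integral_biUnion_finset (box z R) (fun y _ => measurableSet_cube y) hdisj
      (fun y hy => integrableOn_cube_energyDensity φ hφ S u I hI y (hcorner y hy)),
    Finset.mul_sum]
  exact Finset.sum_congr rfl fun y hy => integral_cube_energyDensity_eq φ hφ S u I hI y (hcorner y hy)

/-- ★★★ THE SANDWICH (the lattice ↔ continuum energy dictionary, constant ONE, boundary layer one lattice step): for the Courant `P1`
interpolant `I` of data on `box z (R+1)`,
`∑_{w ∈ box z (R−1)} ∑_μ ‖u (w + e_μ) − u w‖² ≤ ∫_{z − R < x < z + R + 1} ∑_i ‖∂_i I‖² ≤ ∑_{w ∈ box z (R+1)} ∑_μ ‖u (w + e_μ) − u w‖²`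
— the organ's lattice Dirichlet energy and the continuum Dirichlet energy of the interpolant agree up to one boundary layer. -/
theorem bondEnergy_le_integral_bigBox_le_bondEnergy
    (hφ : ∀ t, φ t = max 0 (1 + min 0 (min (t 0) (min (t 1) (t 2))) - max 0 (max (t 0) (max (t 1) (t 2)))))
    (S : Finset (Zd 3)) (u : Zd 3 → E) (I : EuclideanSpace ℝ (Fin 3) → E)
    (hI : ∀ x, I x = ∑ w ∈ S, φ (fun i => x i - (w i : ℝ)) • u w)
    (z : Zd 3) (R : ℤ) (hS : ∀ w ∈ box z (R + 1), w ∈ S) :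
    ∑ w ∈ box z (R - 1), ∑ μ : Fin 3, ‖u (w + unitVec μ) - u w‖ ^ 2 ≤
      ∫ x in {x : EuclideanSpace ℝ (Fin 3) | ∀ i, (z i : ℝ) - R < x i ∧ x i < z i + R + 1},
        ∑ i : Fin 3, ‖fderiv ℝ I x (EuclideanSpace.single i (1:ℝ))‖ ^ 2 ∧
    ∫ x in {x : EuclideanSpace ℝ (Fin 3) | ∀ i, (z i : ℝ) - R < x i ∧ x i < z i + R + 1},
        ∑ i : Fin 3, ‖fderiv ℝ I x (EuclideanSpace.single i (1:ℝ))‖ ^ 2 ≤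
      ∑ w ∈ box z (R + 1), ∑ μ : Fin 3, ‖u (w + unitVec μ) - u w‖ ^ 2 := by
  rw [integral_bigBox_energyDensity_eq φ hφ S u I hI z R hS]
  exact ⟨bondEnergy_le_sixth_sum_paths u z R, sixth_sum_paths_le_bondEnergy u z R⟩

end Summit.QuantumFields.YangMills.Theorems.PoincareLipschitzKuhnEnergy
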